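import Literature.NumberTheory.Transcendental.MZVSimplexRep
import Mathlib.Analysis.SpecialFunctions.NonIntegrable
import Mathlib.Analysis.SpecialFunctions.Integrals.Basic
import Mathlib.Algebra.Polynomial.Div
import Mathlib.Algebra.Polynomial.FieldDivision
import HarnessLib

/-!
# Brown's theorem on the periods of `𝔐_{0,n}`: the cases of dimension `0` and `1`

Companion to `GenusZeroPeriodsMZV.lean` (the named fact
`Literature.NumberTheory.Transcendental.GenusZeroPeriodsMZV`: an absolutely convergent integral
over the standard cell of a regular function `P/(∏ tᵢ^{bᵢ} ∏ (1-tᵢ)^{cᵢ} ∏_{i<j} (tᵢ-tⱼ)^{aᵢⱼ})`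
on `𝔐_{0,ℓ+3}` lies in `∑_{w ≤ ℓ} 𝒵_w` [Brown, Ann. Sci. ÉNS 42 (2009), Thm 1.1, Cor 8.3]).
Here the two lowest-dimensional cases are PROVED, verbatim in the shape of the fact
(`GenusZeroPeriodsMZV.integral_mem_iSup_mzvSpace_of_le_one`):

* `ℓ = 0` (`𝔐_{0,3}` is a point): the cell `ℝ⁰` has volume `1`, the integrand is the rational
  constant `P`, and `P ∈ ℚ = 𝒵₀` (`integral_mem_iSup_mzvSpace_zero`);
* `ℓ = 1` (`𝔐_{0,4} = ℙ¹ ∖ {0, 1, ∞}`): an absolutely convergent `∫₀¹ P(t)/(t^b (1-t)^c) dt`,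
  `P ∈ ℚ[t]`, is rational (`integral_mem_iSup_mzvSpace_one`). The point is the convergence
  criterion, the one-variable case of [Brown 2009, Lemma 7.4] (absolute convergence ⇔ no poles
  along the boundary of the closed cell): a pole of integer order is not integrable
  (`not_integrableOn_Ioo_zpow_mul`, by comparison with `|x - x₀|⁻¹` and
  `not_intervalIntegrable_of_sub_inv_isBigO_punctured`), so integrability near `0` forces
  `X^b ∣ P` (`X_pow_dvd_of_integrableOn`) and integrability near `1` forces `(X - 1)^c ∣ P`
  (`X_sub_C_pow_dvd_of_integrableOn`); the divisibilities descend from `ℝ[X]` to `ℚ[X]`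
  (`Polynomial.map_dvd_map`), the integrand is `± R(t)` with `R ∈ ℚ[t]`, and
  `∫₀¹ R = ∑ₙ rₙ/(n+1) ∈ ℚ`. Note `𝒵₁ = 0` (no admissible index of weight `1`), so the weight
  bound `≤ 1` of the fact is consistent only because `𝒵₀ = ℚ` is included.

The transfer between the cell `KZ.openOrderedSimplex 1 ⊆ ℝ^{Fin 1}` and the interval `(0, 1)` is
`MeasurableEquiv.funUnique` (volume preserving). Nothing here is specific to Brown's proof; from
`ℓ = 2` on (`ζ(2) = ∫∫_{1>t₀>t₁>0} dt₀dt₁/(t₀(1-t₁))`) genuine multiple zeta values appear and the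
theorem is deep.

References: F. Brown, *Multiple zeta values and periods of moduli spaces `𝔐̄_{0,n}`*, Ann. Sci.
ÉNS 42 (2009), Thm 1.1, Lemma 7.4, Cor 8.3.
-/

noncomputable section

open MeasureTheory Set Filter Polynomial
open scoped Topology

namespace Literature.NumberTheory.Transcendental

namespace GenusZeroPeriodsMZV

/-- **A pole of integer order is not integrable.** If `k ≤ -1`, `φ` is continuous at `x₀` with
`φ x₀ ≠ 0`, then `x ↦ (x - x₀)^k φ(x)` is not integrable on any open interval `(u, v)`, `u < v`,
whose closure contains `x₀` (comparison with `|x - x₀|⁻¹`,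
`not_intervalIntegrable_of_sub_inv_isBigO_punctured`). [folklore] -/
theorem not_integrableOn_Ioo_zpow_mul {k : ℤ} (hk : k ≤ -1) {x₀ : ℝ} {φ : ℝ → ℝ}
    (hφ : ContinuousAt φ x₀) (h0 : φ x₀ ≠ 0) {u v : ℝ} (huv : u < v) (hx₀ : x₀ ∈ uIcc u v) :
    ¬ IntegrableOn (fun x : ℝ => (x - x₀) ^ k * φ x) (Ioo u v) volume := by
  intro hint
  have hII : IntervalIntegrable (fun x : ℝ => (x - x₀) ^ k * φ x) volume u v :=
    (intervalIntegrable_iff_integrableOn_Ioo_of_le huv.le).2 hint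
  refine not_intervalIntegrable_of_sub_inv_isBigO_punctured ?_ huv.ne hx₀ hII
  have hφ' : ∀ᶠ x in 𝓝 x₀, |φ x₀| / 2 ≤ |φ x| := by
    have hε : 0 < |φ x₀| / 2 := half_pos (abs_pos.2 h0)
    filter_upwards [Metric.tendsto_nhds.1 hφ _ hε] with x hx
    rw [Real.dist_eq] at hx
    have := abs_sub_abs_le_abs_sub (φ x₀) (φ x)
    rw [abs_sub_comm] at this
    linarith
  have hnear : ∀ᶠ x in 𝓝[≠] x₀, |x - x₀| < 1 ∧ x ≠ x₀ := by
    rw [eventually_nhdsWithin_iff]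
    filter_upwards [Metric.ball_mem_nhds x₀ one_pos] with x hx hx0
    exact ⟨by rwa [Metric.mem_ball, Real.dist_eq] at hx, hx0⟩
  refine Asymptotics.IsBigO.of_bound (2 / |φ x₀|) ?_
  filter_upwards [hnear, mem_nhdsWithin_of_mem_nhds hφ'] with x hx hφx
  obtain ⟨hx1, hx0⟩ := hx
  have hpos : 0 < |x - x₀| := abs_pos.2 (sub_ne_zero.2 hx0)
  rw [Real.norm_eq_abs, Real.norm_eq_abs, abs_mul, abs_inv]
  have hxk : |x - x₀|⁻¹ ≤ |(x - x₀) ^ k| := by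
    rw [abs_zpow, ← zpow_neg_one]
    exact zpow_le_zpow_right_of_le_one₀ hpos hx1.le hk
  have h1 : 1 ≤ 2 / |φ x₀| * |φ x| := by
    rw [div_mul_eq_mul_div, le_div_iff₀ (abs_pos.2 h0)]
    linarith
  calc |x - x₀|⁻¹ ≤ |(x - x₀) ^ k| * 1 := by rw [mul_one]; exact hxk
    _ ≤ |(x - x₀) ^ k| * (2 / |φ x₀| * |φ x|) := mul_le_mul_of_nonneg_left h1 (abs_nonneg _)
    _ = 2 / |φ x₀| * (|(x - x₀) ^ k| * |φ x|) := by ring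

/-- **Absolute convergence at `0` forces divisibility by `X^b`.** If
`x ↦ P(x) / (x^b (1-x)^c)` is integrable on `(0, δ)`, `δ > 0`, then `X^b ∣ P`: otherwise, with
`P = X^v Q`, `Q(0) ≠ 0`, `v < b`, the integrand is `x^{v-b} · Q(x)/(1-x)^c`, a pole of integer
order. One-variable case of [Brown 2009, Lemma 7.4]. [folklore] -/
theorem X_pow_dvd_of_integrableOn {P : ℝ[X]} {b c : ℕ} {δ : ℝ} (hδ : 0 < δ)
    (h : IntegrableOn (fun x : ℝ => P.eval x / (x ^ b * (1 - x) ^ c)) (Ioo 0 δ) volume) :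
    (X : ℝ[X]) ^ b ∣ P := by
  rcases eq_or_ne P 0 with rfl | hP
  · exact dvd_zero _
  obtain ⟨Q, hPQ, hQ⟩ := P.exists_eq_pow_rootMultiplicity_mul_and_not_dvd hP 0
  simp only [map_zero, sub_zero] at hPQ hQ
  set v := P.rootMultiplicity 0 with hv
  by_cases hbv : b ≤ v
  · rw [hPQ]
    exact Dvd.dvd.mul_right (pow_dvd_pow X hbv) Q
  exfalso
  push Not at hbv
  have hQ0 : Q.eval 0 ≠ 0 := by
    rwa [Polynomial.X_dvd_iff, Polynomial.coeff_zero_eq_eval_zero] at hQ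
  have hEq : EqOn (fun x : ℝ => P.eval x / (x ^ b * (1 - x) ^ c))
      (fun x => (x - 0) ^ ((v : ℤ) - b) * (Q.eval x / (1 - x) ^ c)) (Ioo 0 δ) := by
    intro x hx
    have hx0 : x ≠ 0 := hx.1.ne'
    simp only [sub_zero]
    rw [hPQ, Polynomial.eval_mul, Polynomial.eval_pow, Polynomial.eval_X, zpow_sub₀ hx0,
      zpow_natCast, zpow_natCast, div_mul_div_comm]
  refine not_integrableOn_Ioo_zpow_mul (k := (v : ℤ) - b) (by omega) ?_ ?_ hδ left_mem_uIcc
    (h.congr_fun hEq measurableSet_Ioo)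
  · exact Q.continuousAt.div (((continuous_const.sub continuous_id).pow c).continuousAt)
      (by simp)
  · simpa using hQ0

/-- **Absolute convergence at `1` forces divisibility by `(X - 1)^c`.** If
`x ↦ P(x) / (x^b (1-x)^c)` is integrable on `(δ, 1)`, `δ < 1`, then `(X - 1)^c ∣ P`.
One-variable case of [Brown 2009, Lemma 7.4]. [folklore] -/
theorem X_sub_C_pow_dvd_of_integrableOn {P : ℝ[X]} {b c : ℕ} {δ : ℝ} (hδ1 : δ < 1)
    (h : IntegrableOn (fun x : ℝ => P.eval x / (x ^ b * (1 - x) ^ c)) (Ioo δ 1) volume) :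
    (X - C 1 : ℝ[X]) ^ c ∣ P := by
  rcases eq_or_ne P 0 with rfl | hP
  · exact dvd_zero _
  obtain ⟨Q, hPQ, hQ⟩ := P.exists_eq_pow_rootMultiplicity_mul_and_not_dvd hP 1
  set v := P.rootMultiplicity 1 with hv
  by_cases hcv : c ≤ v
  · rw [hPQ]
    exact Dvd.dvd.mul_right (pow_dvd_pow _ hcv) Q
  exfalso
  push Not at hcv
  have hQ1 : Q.eval 1 ≠ 0 := by
    rwa [Polynomial.dvd_iff_isRoot, Polynomial.IsRoot.def] at hQ
  have hEq : EqOn (fun x : ℝ => P.eval x / (x ^ b * (1 - x) ^ c))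
      (fun x => (x - 1) ^ ((v : ℤ) - c) * (Q.eval x / (x ^ b * (-1) ^ c))) (Ioo δ 1) := by
    intro x hx
    have hx1 : x - 1 ≠ 0 := sub_ne_zero.2 hx.2.ne
    have hneg : (1 - x : ℝ) ^ c = (-1) ^ c * (x - 1) ^ c := by rw [← mul_pow]; ring_nf
    simp only
    rw [hPQ, Polynomial.eval_mul, Polynomial.eval_pow, Polynomial.eval_sub, Polynomial.eval_X,
      Polynomial.eval_C, hneg, zpow_sub₀ hx1, zpow_natCast, zpow_natCast, div_mul_div_comm]
    congr 1
    ring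
  refine not_integrableOn_Ioo_zpow_mul (k := (v : ℤ) - c) (by omega) ?_ ?_ hδ1 right_mem_uIcc
    (h.congr_fun hEq measurableSet_Ioo)
  · exact Q.continuousAt.div (((continuous_pow b).mul continuous_const).continuousAt) (by simp)
  · simp [hQ1]

/-- The genus-zero integrand in dimension one, written in the single variable `x = t 0`:
`P(t)/(t₀^{b₀} (1-t₀)^{c₀} · 1)`, the numerator being the univariate polynomial
`aeval (fun _ => X) p` evaluated at `x`. [folklore] -/
theorem integrand_one_apply (p : MvPolynomial (Fin 1) ℚ) (a : Fin 1 → Fin 1 → ℕ)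
    (b c : Fin 1 → ℕ) (x : ℝ) :
    MvPolynomial.aeval (fun _ : Fin 1 => x) p /
        ((∏ i, (fun _ : Fin 1 => x) i ^ b i) * (∏ i, (1 - (fun _ : Fin 1 => x) i) ^ c i) *
          ∏ i : Fin 1, ∏ j : Fin 1,
            if i < j then ((fun _ : Fin 1 => x) i - (fun _ : Fin 1 => x) j) ^ a i j else 1) =
      ((MvPolynomial.aeval (fun _ : Fin 1 => (X : ℚ[X])) p).map (algebraMap ℚ ℝ)).eval x /
        (x ^ b 0 * (1 - x) ^ c 0) := by
  have hP : MvPolynomial.aeval (fun _ : Fin 1 => x) p =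
      ((MvPolynomial.aeval (fun _ : Fin 1 => (X : ℚ[X])) p).map (algebraMap ℚ ℝ)).eval x := by
    rw [Polynomial.eval_map, ← Polynomial.aeval_def, ← AlgHom.comp_apply]
    refine congrFun (congrArg DFunLike.coe (MvPolynomial.algHom_ext (fun i => ?_)).symm) p
    simp
  simp only [Fin.prod_univ_one, lt_self_iff_false, if_false, mul_one, hP]

/-- **Brown's theorem in dimension `1` (`𝔐_{0,4}`).** An absolutely convergent
`∫₀¹ P(t)/(t^b (1-t)^c) dt`, `P ∈ ℚ[t]`, is a rational number: absolute convergence forces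
`t^b (t-1)^c ∣ P` (`X_pow_dvd_of_integrableOn`, `X_sub_C_pow_dvd_of_integrableOn`), so the
integrand is `± R(t)` with `R ∈ ℚ[t]` and the integral is `± ∑ₙ rₙ/(n+1) ∈ ℚ = 𝒵₀ ⊆ 𝒵₀ + 𝒵₁`.
This is the case `ℓ = 1` of `GenusZeroPeriodsMZV` [Brown 2009, Thm 1.1, Cor 8.3; Lemma 7.4 for the
convergence criterion]. [cite: BrownENS2009, Thm 1.1 and Cor 8.3] -/
theorem integral_mem_iSup_mzvSpace_one (p : MvPolynomial (Fin 1) ℚ) (a : Fin 1 → Fin 1 → ℕ)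
    (b c : Fin 1 → ℕ)
    (h : IntegrableOn (fun t : Fin 1 → ℝ => MvPolynomial.aeval t p /
        ((∏ i, t i ^ b i) * (∏ i, (1 - t i) ^ c i) *
          ∏ i, ∏ j, if i < j then (t i - t j) ^ a i j else 1))
      (KZ.openOrderedSimplex 1) volume) :
    (∫ t in KZ.openOrderedSimplex 1, MvPolynomial.aeval t p /
        ((∏ i, t i ^ b i) * (∏ i, (1 - t i) ^ c i) *
          ∏ i, ∏ j, if i < j then (t i - t j) ^ a i j else 1)) ∈
      ⨆ (w : ℕ) (_ : w ≤ 1), mzvSpace w := by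
  set f : (Fin 1 → ℝ) → ℝ := fun t => MvPolynomial.aeval t p /
        ((∏ i, t i ^ b i) * (∏ i, (1 - t i) ^ c i) *
          ∏ i, ∏ j, if i < j then (t i - t j) ^ a i j else 1) with hf
  set P : ℚ[X] := MvPolynomial.aeval (fun _ : Fin 1 => (X : ℚ[X])) p with hP
  set Pr : ℝ[X] := P.map (algebraMap ℚ ℝ) with hPr
  have hfg : ∀ x : ℝ, f (fun _ => x) = Pr.eval x / (x ^ b 0 * (1 - x) ^ c 0) := fun x =>
    integrand_one_apply p a b c x
  -- transfer to the real line
  set e := MeasurableEquiv.funUnique (Fin 1) ℝ with he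
  have hmp : MeasurePreserving e.symm volume volume :=
    (volume_preserving_funUnique (Fin 1) ℝ).symm e
  have hemb : MeasurableEmbedding e.symm := e.symm.measurableEmbedding
  have hsymm : ∀ x : ℝ, e.symm x = fun _ => x := fun x => rfl
  have hpre : e.symm ⁻¹' (KZ.openOrderedSimplex 1) = Ioo 0 1 := by
    ext x
    simp only [mem_preimage, hsymm, KZ.openOrderedSimplex, mem_setOf_eq, forall_const, mem_Ioo]
    exact ⟨fun h => ⟨h.1, h.2.1⟩, fun h => ⟨h.1, h.2, fun i j hij =>
      absurd hij (by rw [Subsingleton.elim i j]; exact lt_irrefl _)⟩⟩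
  have hint : IntegrableOn (fun x : ℝ => Pr.eval x / (x ^ b 0 * (1 - x) ^ c 0)) (Ioo 0 1)
      volume := by
    have h1 := (hmp.integrableOn_comp_preimage hemb).2 h
    rw [hpre] at h1
    exact h1.congr_fun (fun x _ => by rw [Function.comp_apply, hsymm, hfg]) measurableSet_Ioo
  have hval : (∫ t in KZ.openOrderedSimplex 1, f t) =
      ∫ x in Ioo (0 : ℝ) 1, Pr.eval x / (x ^ b 0 * (1 - x) ^ c 0) := by
    rw [← hmp.setIntegral_preimage_emb hemb f (KZ.openOrderedSimplex 1), hpre]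
    exact setIntegral_congr_fun measurableSet_Ioo fun x _ => by rw [hsymm, hfg]
  -- absolute convergence forces divisibility, over `ℝ` and then over `ℚ`
  have hb : (X : ℝ[X]) ^ b 0 ∣ Pr :=
    X_pow_dvd_of_integrableOn one_half_pos (hint.mono_set (Ioo_subset_Ioo_right (by norm_num)))
  have hc : (X - C 1 : ℝ[X]) ^ c 0 ∣ Pr :=
    X_sub_C_pow_dvd_of_integrableOn (δ := 1 / 2) (by norm_num)
      (hint.mono_set (Ioo_subset_Ioo_left (by norm_num)))
  have hinj : Function.Injective (algebraMap ℚ ℝ) := (algebraMap ℚ ℝ).injective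
  have hbq : (X : ℚ[X]) ^ b 0 ∣ P := by
    rw [← Polynomial.map_dvd_map (algebraMap ℚ ℝ) hinj ((monic_X (R := ℚ)).pow _)]
    simpa using hb
  have hcq : (X - C 1 : ℚ[X]) ^ c 0 ∣ P := by
    rw [← Polynomial.map_dvd_map (algebraMap ℚ ℝ) hinj ((monic_X_sub_C (1 : ℚ)).pow _)]
    simpa using hc
  have hcop : IsCoprime ((X : ℚ[X]) ^ b 0) ((X - C 1) ^ c 0) :=
    (show IsCoprime (X : ℚ[X]) (X - C 1) from ⟨1, -1, by simp⟩).pow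
  obtain ⟨R, hR⟩ := hcop.mul_dvd hbq hcq
  -- the integrand is `(-1)^c · R` on `(0, 1)`
  have hEq : EqOn (fun x : ℝ => Pr.eval x / (x ^ b 0 * (1 - x) ^ c 0))
      (fun x => (-1) ^ c 0 * (R.map (algebraMap ℚ ℝ)).eval x) (Ioo 0 1) := by
    intro x hx
    have hx0 : x ≠ 0 := hx.1.ne'
    have hx1 : (1 - x) ≠ 0 := sub_ne_zero.2 hx.2.ne'
    have hneg : (x - 1 : ℝ) ^ c 0 = (-1) ^ c 0 * (1 - x) ^ c 0 := by rw [← mul_pow]; ring_nf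
    simp only [hPr, hR, Polynomial.map_mul, Polynomial.map_pow, Polynomial.map_sub,
      Polynomial.map_X, map_one, Polynomial.map_one, Polynomial.eval_mul, Polynomial.eval_pow,
      Polynomial.eval_sub, Polynomial.eval_X, Polynomial.eval_one]
    rw [hneg]
    field_simp
  rw [hval, setIntegral_congr_fun measurableSet_Ioo hEq]
  -- the integral of a rational polynomial over `(0, 1)` is rational
  set q : ℚ := (-1) ^ c 0 * ∑ n ∈ Finset.range (R.natDegree + 1), R.coeff n / (n + 1) with hq
  have hpoly : ∫ x in Ioo (0 : ℝ) 1, (-1 : ℝ) ^ c 0 * (R.map (algebraMap ℚ ℝ)).eval x = q := by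
    have hRx : ∀ x : ℝ, (R.map (algebraMap ℚ ℝ)).eval x =
        ∑ n ∈ Finset.range (R.natDegree + 1), (R.coeff n : ℝ) * x ^ n := by
      intro x
      rw [Polynomial.eval_map, ← Polynomial.aeval_def, Polynomial.aeval_eq_sum_range]
      simp [Algebra.smul_def]
    rw [← integral_Ioc_eq_integral_Ioo, ← intervalIntegral.integral_of_le zero_le_one,
      intervalIntegral.integral_const_mul]
    simp_rw [hRx]
    rw [intervalIntegral.integral_finsetSum]
    · simp_rw [intervalIntegral.integral_const_mul, integral_pow]
      rw [hq]
      push_cast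
      congr 1
      refine Finset.sum_congr rfl fun n _ => ?_
      rw [one_pow, zero_pow (Nat.succ_ne_zero n), sub_zero, mul_one_div]
    · intro n _
      exact (continuous_const.mul (continuous_pow n)).intervalIntegrable _ _
  rw [hpoly]
  have h0 : ((q : ℚ) : ℝ) ∈ mzvSpace 0 := by
    rw [mzvSpace_zero_eq, ← Rat.smul_one_eq_cast]
    exact Submodule.smul_mem _ q (Submodule.subset_span rfl)
  exact le_iSup₂ (f := fun (w : ℕ) (_ : w ≤ 1) => mzvSpace w) 0 zero_le_one h0

/-- **Brown's theorem in dimension `0` (`𝔐_{0,3}` = a point).** The `0`-dimensional cell is the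
point `ℝ⁰` of volume `1`, the integrand is the rational constant `P ∈ ℚ`, and the integral is
`P ∈ ℚ = 𝒵₀`. The case `ℓ = 0` of `GenusZeroPeriodsMZV` [Brown 2009, Thm 1.1, Cor 8.3].
[cite: BrownENS2009, Thm 1.1 and Cor 8.3] -/
theorem integral_mem_iSup_mzvSpace_zero (p : MvPolynomial (Fin 0) ℚ) (a : Fin 0 → Fin 0 → ℕ)
    (b c : Fin 0 → ℕ) :
    (∫ t in KZ.openOrderedSimplex 0, MvPolynomial.aeval t p /
        ((∏ i, t i ^ b i) * (∏ i, (1 - t i) ^ c i) *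
          ∏ i, ∏ j, if i < j then (t i - t j) ^ a i j else 1)) ∈
      ⨆ (w : ℕ) (_ : w ≤ 0), mzvSpace w := by
  have hS : KZ.openOrderedSimplex 0 = univ := by
    ext t
    simp only [KZ.openOrderedSimplex, mem_setOf_eq, IsEmpty.forall_iff, true_and, mem_univ,
      iff_true]
    exact fun i => i.elim0
  obtain ⟨t₀, hvol⟩ : ∃ t₀ : Fin 0 → ℝ, (volume : Measure (Fin 0 → ℝ)) = Measure.dirac t₀ :=
    ⟨_, by rw [volume_pi, Measure.pi_of_empty]⟩
  rw [hS, Measure.restrict_univ, hvol, integral_dirac, MvPolynomial.eq_C_of_isEmpty p]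
  simp only [Finset.univ_eq_empty, Finset.prod_empty, mul_one, div_one, MvPolynomial.aeval_C,
    eq_ratCast]
  have h0 : ((p.coeff 0 : ℚ) : ℝ) ∈ mzvSpace 0 := by
    rw [mzvSpace_zero_eq, ← Rat.smul_one_eq_cast]
    exact Submodule.smul_mem _ _ (Submodule.subset_span rfl)
  exact le_iSup₂ (f := fun (w : ℕ) (_ : w ≤ 0) => mzvSpace w) 0 le_rfl h0

/-- **Brown's theorem in dimensions `≤ 1`**: the cases `ℓ = 0, 1` of the named fact
`GenusZeroPeriodsMZV` (an absolutely convergent cell integral of a regular function on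
`𝔐_{0,ℓ+3}` lies in `∑_{w ≤ ℓ} 𝒵_w`), proved: `ℚ = 𝒵₀` in dimension `0`, and in dimension `1`
absolute convergence forces the integrand to be a polynomial. [Brown 2009, Thm 1.1, Cor 8.3]
[cite: BrownENS2009, Thm 1.1 and Cor 8.3] -/
theorem integral_mem_iSup_mzvSpace_of_le_one (ℓ : ℕ) (hℓ : ℓ ≤ 1) (p : MvPolynomial (Fin ℓ) ℚ)
    (a : Fin ℓ → Fin ℓ → ℕ) (b c : Fin ℓ → ℕ)
    (h : IntegrableOn (fun t : Fin ℓ → ℝ => MvPolynomial.aeval t p /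
        ((∏ i, t i ^ b i) * (∏ i, (1 - t i) ^ c i) *
          ∏ i, ∏ j, if i < j then (t i - t j) ^ a i j else 1))
      (KZ.openOrderedSimplex ℓ) volume) :
    (∫ t in KZ.openOrderedSimplex ℓ, MvPolynomial.aeval t p /
        ((∏ i, t i ^ b i) * (∏ i, (1 - t i) ^ c i) *
          ∏ i, ∏ j, if i < j then (t i - t j) ^ a i j else 1)) ∈
      ⨆ (w : ℕ) (_ : w ≤ ℓ), mzvSpace w := by
  interval_cases ℓ
  · exact integral_mem_iSup_mzvSpace_zero p a b c
  · exact integral_mem_iSup_mzvSpace_one p a b c h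

end GenusZeroPeriodsMZV

end Literature.NumberTheory.Transcendental
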